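import Mathlib
import HarnessLib
import Literature.Computability.AlgebraicComplexity.SymmetricCircuitPairing
import Literature.Computability.AlgebraicComplexity.SymmetricCircuitScaledInputs
import Literature.Computability.AlgebraicComplexity.SymmetricCircuitPullback
import Literature.Computability.AlgebraicComplexity.SymmetricCircuitFibreFold
import Literature.Computability.AlgebraicComplexity.SymmetricCircuitConstOutputs
import Literature.Computability.AlgebraicComplexity.SymmetricCircuitHadamard
import Literature.Computability.AlgebraicComplexity.SymmetricCircuitLinCombOutputsSymmetry
import Literature.Computability.AlgebraicComplexity.SymmetricCircuitFold

/-!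
# Route MonotoneRestoration — crux `OrbitRestorationQP` (stmt-ValiantsHypothesis-18293), line
# `depth-three-rung`, stub B `stub_circuitOfEquivariantTerms`: TOOLS (route-independent)

Route-independent part (no `Theses` import) of the landing of the registered stub B of
`Cruxes/OrbitRestorationQP/Lines/depth_three_rung.lean`; the stub itself is concluded in
`MonotoneRestorationOrbitRestorationQPCircuitOfEquivariantTerms.lean`.

* `eqvTerms_affine_eq` — a polynomial of total degree `≤ 1` is `C (coeff 0) + Σ_x C (coeff_x) · X_x`;
* `eqvTerms_symmetric_size` — **the construction**: for `n ≥ 1` and a nonempty multiset `T` of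
  multisets of affine forms on the `n × n` matrix, STABLE under the diagonal action of `Sym(Fin n)`,
  with `|T| ≤ s` and members of cardinality `≤ s`, the polynomial `Σ_{m ∈ T} Π m` is computed by a
  square-symmetric labelled arithmetic circuit (Dawar–Wilsenach Defs. 2.2/3.7) of SIZE
  `≤ 2n² + 4s²n² + 6s² + s⁴ + 6s + 6`.  Assembled from the tree's equivariant multi-output calculus on
  the finite `Sym(Fin n)`-sets `A` = the forms occurring, `B` = the distinct members of `T`, and the
  slots `Y = {(m, ℓ, j) : ℓ ∈ m, j < count ℓ m}`: scaled inputs (`exists_scaledInputs`) → pull-back to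
  `A × X` and Hadamard product with the invariant constants `coeff_x(ℓ)` (`exists_constOutputs`,
  `exists_pairing`, `exists_hadamard`) → fibre sum along `A × X → A` (`exists_fibreSum`) plus
  `coeff_0(ℓ)` (`exists_linCombOutputs`): outputs `ℓ ↦ ℓ` → pull-back to the slots and fibre PRODUCT
  along `Y ⊔ B → B` (one dummy constant-`1` slot per member keeps the map surjective,
  `exists_fibreProd`): outputs `m ↦ Π m` (`Finset.prod_multiset_count`) → Hadamard product with the
  invariant multiplicities `count m T` and orbit sum over `B` (`exists_sumOutputs`):
  `Σ_{m ∈ B} count(m) · Π m = Σ_{m ∈ T} Π m` (`Finset.sum_multiset_map_count`);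
* bookkeeping: `eqvTerms_prod_ite_lt`, `eqvTerms_size_arith`.

## References
* A. Dawar, G. Wilsenach, *Symmetric arithmetic circuits*, ToC 21 (2025), Defs. 2.2, 3.6, 3.7.
  [DawarWilsenach2025]
* A. Dawar, B. Pago, T. Seppelt, *Symmetric algebraic circuits and homomorphism polynomials*,
  arXiv:2502.06740 (2025), §5 (symmetric circuits built gate-by-gate over `Γ`-sets). [DawarPagoSeppelt2025]
-/

noncomputable section

set_option linter.dupNamespace false

namespace Summit.ValiantsHypothesis.ValiantsHypothesis.Theorems

open Literature.Computability.AlgebraicComplexity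

/-- A polynomial of total degree `≤ 1` is its constant term plus a linear form:
`ℓ = C (coeff 0 ℓ) + Σ_x C (coeff x ℓ) · X_x`. [folklore] -/
theorem eqvTerms_affine_eq {R X : Type} [CommSemiring R] [Fintype X] [DecidableEq X]
    (ℓ : MvPolynomial X R) (hℓ : ℓ.totalDegree ≤ 1) :
    ℓ = MvPolynomial.C (MvPolynomial.coeff 0 ℓ) +
      ∑ x : X, MvPolynomial.C (MvPolynomial.coeff (Finsupp.single x 1) ℓ) * MvPolynomial.X x := by
  classical
  refine MvPolynomial.ext _ _ fun d => ?_
  simp only [MvPolynomial.coeff_add, MvPolynomial.coeff_C, MvPolynomial.coeff_sum,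
    MvPolynomial.coeff_C_mul, MvPolynomial.coeff_X]
  have hsingle : ∀ x : X, ((Finsupp.single x 1 : X →₀ ℕ).sum fun _ e => e) = 1 := fun x =>
    Finsupp.sum_single_index rfl
  rcases Nat.lt_or_ge 1 (d.sum fun _ e => e) with hbig | hsmall
  · -- degree ≥ 2: both sides vanish
    have hcoeff : MvPolynomial.coeff d ℓ = 0 := by
      rw [← MvPolynomial.notMem_support_iff]
      exact fun hmem => by have := MvPolynomial.le_totalDegree hmem; omega
    have hd0 : (0 : X →₀ ℕ) ≠ d := by rintro rfl; simp at hbig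
    rw [hcoeff, if_neg hd0, zero_add, eq_comm]
    refine Finset.sum_eq_zero fun x _ => ?_
    rw [if_neg, mul_zero]
    rintro rfl
    exact absurd (hsingle x ▸ hbig) (lt_irrefl _)
  · rcases Nat.eq_zero_or_pos (d.sum fun _ e => e) with h0 | h1
    · -- `d = 0`
      have hd : d = 0 := (Finsupp.degree_eq_zero_iff d).1 h0
      subst hd
      rw [if_pos rfl, Finset.sum_eq_zero, add_zero]
      intro x _
      rw [if_neg, mul_zero]
      exact fun h => by have := hsingle x; rw [h] at this; simp at this
    · -- `d = single x 1`
      have h1' : (d.sum fun _ e => e) = 1 := by omega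
      obtain ⟨x, rfl⟩ := (Finsupp.sum_eq_one_iff d).1 h1'
      rw [if_neg, zero_add, Finset.sum_eq_single x]
      · rw [if_pos rfl, mul_one]
      · intro y _ hy
        rw [if_neg, mul_zero]
        exact fun h => hy (Finsupp.single_left_injective one_ne_zero h)
      · exact fun h => absurd (Finset.mem_univ x) h
      · exact fun h => by have := hsingle x; rw [← h] at this; simp at this

/-- `Π_{j : Fin s} (if j < c then x else 1) = x ^ c` for `c ≤ s`. [folklore] -/
theorem eqvTerms_prod_ite_lt {M : Type} [CommMonoid M] (s c : ℕ) (hc : c ≤ s) (x : M) :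
    ∏ j : Fin s, (if (j : ℕ) < c then x else 1) = x ^ c := by
  rw [Fin.prod_univ_eq_prod_range (fun j => if j < c then x else 1) s, Finset.prod_ite,
    Finset.prod_const_one, mul_one, Finset.prod_const]
  congr 1
  rw [show (Finset.range s).filter (fun j => j < c) = Finset.range c from by
    ext j; simp only [Finset.mem_filter, Finset.mem_range]; omega]
  exact Finset.card_range c

/-- **Core construction.** For `n ≥ 1` and a nonempty multiset `T` of multisets of affine forms
on the `n × n` matrix, stable under the diagonal action of `Sym(Fin n)`, with `|T| ≤ s` and every
member of cardinality `≤ s`, the polynomial `Σ_{m ∈ T} Π m` is computed by a square-symmetric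
labelled circuit with at most `2n² + 4s²n² + 6s² + s⁴ + 6s + 6` gates. Assembled from the tree's
equivariant multi-output circuit calculus (scaled inputs, constant families, pull-backs, pairing,
Hadamard products, linear combinations, fibre sums/products, orbit sums). [folklore] -/
theorem eqvTerms_symmetric_size {n : ℕ} [NeZero n] (s : ℕ)
    (T : Multiset (Multiset (MvPolynomial (Fin n × Fin n) ℂ))) (hT0 : T ≠ 0)
    (h1 : ∀ m ∈ T, ∀ ℓ ∈ m, ℓ.totalDegree ≤ 1)
    (h2 : Multiset.card T ≤ s) (h3 : ∀ m ∈ T, Multiset.card m ≤ s)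
    (h4 : ∀ σ : Equiv.Perm (Fin n),
      T.map (Multiset.map fun ℓ =>
        MvPolynomial.rename (fun pq : Fin n × Fin n => σ • pq) ℓ) = T) :
    ∃ (G : Type) (_ : Fintype G) (C : LabelledArithCircuit ℂ (Fin n × Fin n) Unit G),
      C.IsSymmetric (Equiv.Perm (Fin n)) ∧ C.eval (C.output ()) = (T.map Multiset.prod).sum ∧
      Fintype.card G ≤ 2 * (n * n) + 4 * (s * s) * (n * n) + 6 * (s * s) + s ^ 4 + 6 * s + 6 := by
  classical
  -- the diagonal renaming action on polynomials
  let ren : Equiv.Perm (Fin n) → MvPolynomial (Fin n × Fin n) ℂ → MvPolynomial (Fin n × Fin n) ℂ :=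
    fun σ ℓ => MvPolynomial.rename (fun pq : Fin n × Fin n => σ • pq) ℓ
  have ren_one : ∀ ℓ, ren 1 ℓ = ℓ := by
    intro ℓ
    change MvPolynomial.rename _ ℓ = ℓ
    rw [show (fun pq : Fin n × Fin n => (1 : Equiv.Perm (Fin n)) • pq) = id from
      funext fun pq => one_smul _ pq, MvPolynomial.rename_id]
    rfl
  have ren_mul : ∀ σ τ ℓ, ren (σ * τ) ℓ = ren σ (ren τ ℓ) := by
    intro σ τ ℓ
    change MvPolynomial.rename _ ℓ = MvPolynomial.rename _ (MvPolynomial.rename _ ℓ)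
    rw [MvPolynomial.rename_rename]
    exact congrArg (fun f => MvPolynomial.rename f ℓ) (funext fun pq => mul_smul σ τ pq)
  have ren_inj : ∀ σ, Function.Injective (ren σ) := fun σ =>
    MvPolynomial.rename_injective _ (MulAction.injective σ)
  have h4' : ∀ σ, T.map (Multiset.map (ren σ)) = T := h4
  -- A: the finite `Sym(Fin n)`-set of forms
  let Lf : Finset (MvPolynomial (Fin n × Fin n) ℂ) := T.join.toFinset
  have memLf : ∀ {ℓ}, ℓ ∈ Lf ↔ ∃ m ∈ T, ℓ ∈ m := by intro ℓ; simp [Lf, Multiset.mem_join]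
  have hLf : ∀ σ ℓ, ℓ ∈ Lf → ren σ ℓ ∈ Lf := by
    intro σ ℓ h
    obtain ⟨m, hm, hℓ⟩ := memLf.1 h
    exact memLf.2 ⟨m.map (ren σ), (h4' σ) ▸ Multiset.mem_map_of_mem _ hm,
      Multiset.mem_map_of_mem _ hℓ⟩
  letI instA : MulAction (Equiv.Perm (Fin n)) ↥Lf :=
    { smul := fun σ a => ⟨ren σ a.1, hLf σ a.1 a.2⟩
      one_smul := fun a => Subtype.ext (ren_one a.1)
      mul_smul := fun σ τ a => Subtype.ext (ren_mul σ τ a.1) }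
  -- B: the finite `Sym(Fin n)`-set of distinct terms
  let Mf : Finset (Multiset (MvPolynomial (Fin n × Fin n) ℂ)) := T.toFinset
  have hMf : ∀ σ m, m ∈ Mf → m.map (ren σ) ∈ Mf := by
    intro σ m hm
    rw [Multiset.mem_toFinset] at hm ⊢
    exact (h4' σ) ▸ Multiset.mem_map_of_mem _ hm
  have map_ren_one : ∀ m : Multiset (MvPolynomial (Fin n × Fin n) ℂ), m.map (ren 1) = m :=
    fun m => (Multiset.map_congr rfl fun ℓ _ => ren_one ℓ).trans (Multiset.map_id m)
  have map_ren_mul : ∀ (σ τ) (m : Multiset (MvPolynomial (Fin n × Fin n) ℂ)),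
      m.map (ren (σ * τ)) = (m.map (ren τ)).map (ren σ) := fun σ τ m => by
    rw [Multiset.map_map]; exact Multiset.map_congr rfl fun ℓ _ => ren_mul σ τ ℓ
  letI instB : MulAction (Equiv.Perm (Fin n)) ↥Mf :=
    { smul := fun σ b => ⟨b.1.map (ren σ), hMf σ b.1 b.2⟩
      one_smul := fun b => Subtype.ext (map_ren_one b.1)
      mul_smul := fun σ τ b => Subtype.ext (map_ren_mul σ τ b.1) }
  -- the trivial action on multiplicity indices
  letI instF : MulAction (Equiv.Perm (Fin n)) (Fin s) :=
    { smul := fun _ j => j, one_smul := fun _ => rfl, mul_smul := fun _ _ _ => rfl }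
  -- Y: the slots `(m, ℓ, j)` with `ℓ ∈ m` and `j < count ℓ m`
  let Yp : ↥Mf × ↥Lf × Fin s → Prop := fun y => y.2.1.1 ∈ y.1.1 ∧ (y.2.2 : ℕ) < y.1.1.count y.2.1.1
  have hYp : ∀ (σ : Equiv.Perm (Fin n)) (y : ↥Mf × ↥Lf × Fin s), Yp y → Yp (σ • y) := by
    rintro σ ⟨b, a, j⟩ ⟨hmem, hlt⟩
    refine ⟨?_, ?_⟩
    · change ren σ a.1 ∈ b.1.map (ren σ)
      exact Multiset.mem_map_of_mem _ hmem
    · change ((j : Fin s) : ℕ) < (b.1.map (ren σ)).count (ren σ a.1)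
      rwa [Multiset.count_map_eq_count' _ _ (ren_inj σ)]
  letI instY : MulAction (Equiv.Perm (Fin n)) {y // Yp y} :=
    { smul := fun σ y => ⟨σ • y.1, hYp σ y.1 y.2⟩
      one_smul := fun y => Subtype.ext (one_smul _ y.1)
      mul_smul := fun σ τ y => Subtype.ext (mul_smul σ τ y.1) }
  -- cardinalities
  have cardA : Fintype.card ↥Lf ≤ s * s := by
    rw [Fintype.card_coe]
    calc Lf.card ≤ Multiset.card T.join := Multiset.toFinset_card_le _
      _ = (T.map Multiset.card).sum := Multiset.card_join _
      _ ≤ (T.map fun _ => s).sum := Multiset.sum_map_le_sum_map _ _ fun m hm => h3 m hm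
      _ = Multiset.card T * s := by simp
      _ ≤ s * s := Nat.mul_le_mul_right _ h2
  have cardB : Fintype.card ↥Mf ≤ s := by
    rw [Fintype.card_coe]
    exact (Multiset.toFinset_card_le _).trans h2
  have cardY : Fintype.card {y // Yp y} ≤ s ^ 4 := by
    calc Fintype.card {y // Yp y} ≤ Fintype.card (↥Mf × ↥Lf × Fin s) := Fintype.card_subtype_le _
      _ = Fintype.card ↥Mf * (Fintype.card ↥Lf * s) := by
          rw [Fintype.card_prod, Fintype.card_prod, Fintype.card_fin]
      _ ≤ s * (s * s * s) := Nat.mul_le_mul cardB (Nat.mul_le_mul_right _ cardA)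
      _ = s ^ 4 := by ring
  have cardX : Fintype.card (Fin n × Fin n) = n * n := by simp
  -- S1: the inputs `1 · x_pq`
  obtain ⟨G₁, i₁, C₁, hC₁, hev₁, hc₁⟩ := LabelledArithCircuit.exists_scaledInputs
    (K := ℂ) (X := Fin n × Fin n) (Equiv.Perm (Fin n)) 1
  -- S2: outputs `(a, x) ↦ coeff_x(a) · x`
  obtain ⟨G₂, i₂, C₂, hC₂, hev₂, hc₂⟩ := hC₁.exists_pullback
    (fun y : ↥Lf × (Fin n × Fin n) => y.2) (fun σ y => rfl)
  obtain ⟨G₃, i₃, C₃, hC₃, hev₃, hc₃⟩ := LabelledArithCircuit.exists_constOutputs (K := ℂ)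
    (Fin n × Fin n) (Γ := Equiv.Perm (Fin n))
    (fun y : ↥Lf × (Fin n × Fin n) => MvPolynomial.coeff (Finsupp.single y.2 1) y.1.1)
    (by
      rintro σ ⟨a, x⟩
      change MvPolynomial.coeff (Finsupp.single (σ • x) 1) (ren σ a.1) =
        MvPolynomial.coeff (Finsupp.single x 1) a.1
      rw [← Finsupp.mapDomain_single (f := fun pq : Fin n × Fin n => σ • pq)]
      exact MvPolynomial.coeff_rename_mapDomain _ (MulAction.injective σ) _ _)
  obtain ⟨G₄, i₄, C₄, hC₄, hinl₄, hinr₄, hc₄⟩ := hC₃.exists_pairing hC₂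
  obtain ⟨G₅, i₅, C₅, hC₅, hev₅, hc₅⟩ := hC₄.exists_hadamard
  have ev₅ : ∀ (a : ↥Lf) (x : Fin n × Fin n), C₅.eval (C₅.output (a, x)) =
      MvPolynomial.C (MvPolynomial.coeff (Finsupp.single x 1) a.1) * MvPolynomial.X x := by
    intro a x
    rw [hev₅, hinl₄, hinr₄, hev₃, hev₂, hev₁, map_one, one_mul]
  -- S3: outputs `a ↦ Σ_x coeff_x(a) · x`
  obtain ⟨G₆, i₆, C₆, hC₆, hev₆, hc₆⟩ := hC₅.exists_fibreSum (fun y : ↥Lf × (Fin n × Fin n) => y.1)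
    (fun σ y => rfl) (fun a => ⟨(a, ((0 : Fin n), (0 : Fin n))), rfl⟩)
  have ev₆ : ∀ a : ↥Lf, C₆.eval (C₆.output a) =
      ∑ x : Fin n × Fin n, MvPolynomial.C (MvPolynomial.coeff (Finsupp.single x 1) a.1) *
        MvPolynomial.X x := by
    intro a
    rw [hev₆, Finset.sum_filter, Fintype.sum_prod_type, Finset.sum_comm]
    simp only [ev₅, Finset.sum_ite_eq', Finset.mem_univ, if_true]
  -- S4: outputs `a ↦ a`
  obtain ⟨G₇, i₇, C₇, hC₇, hev₇, hc₇⟩ := LabelledArithCircuit.exists_constOutputs (K := ℂ)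
    (Fin n × Fin n) (Γ := Equiv.Perm (Fin n)) (fun a : ↥Lf => MvPolynomial.coeff 0 a.1)
    (by
      intro σ a
      change MvPolynomial.coeff 0 (ren σ a.1) = MvPolynomial.coeff 0 a.1
      rw [← MvPolynomial.constantCoeff_eq, MvPolynomial.constantCoeff_rename])
  obtain ⟨G₈, i₈, C₈, hC₈, hinl₈, hinr₈, hc₈⟩ := hC₆.exists_pairing hC₇
  obtain ⟨G₉, i₉, C₉, hC₉, hev₉, hc₉⟩ := hC₈.exists_linCombOutputs C₈ 1 1
  have ev₉ : ∀ a : ↥Lf, C₉.eval (C₉.output a) = a.1 := by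
    intro a
    obtain ⟨m, hm, ha⟩ := memLf.1 a.2
    rw [hev₉, hinl₈, hinr₈, ev₆, hev₇, map_one, one_mul, one_mul, add_comm]
    exact (eqvTerms_affine_eq a.1 (h1 m hm a.1 ha)).symm
  -- S5: outputs `m ↦ Π m`
  obtain ⟨G₁₀, i₁₀, C₁₀, hC₁₀, hev₁₀, hc₁₀⟩ := hC₉.exists_pullback
    (fun y : {y // Yp y} => y.1.2.1) (fun σ y => rfl)
  obtain ⟨G₁₁, i₁₁, C₁₁, hC₁₁, hev₁₁, hc₁₁⟩ := LabelledArithCircuit.exists_constOutputs (K := ℂ)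
    (Fin n × Fin n) (Γ := Equiv.Perm (Fin n)) (fun _ : ↥Mf => (1 : ℂ)) (fun _ _ => rfl)
  obtain ⟨G₁₂, i₁₂, C₁₂, hC₁₂, hinl₁₂, hinr₁₂, hc₁₂⟩ := hC₁₀.exists_pairing hC₁₁
  let p' : {y // Yp y} ⊕ ↥Mf → ↥Mf := Sum.elim (fun y => y.1.1) id
  obtain ⟨G₁₃, i₁₃, C₁₃, hC₁₃, hev₁₃, hc₁₃⟩ := hC₁₂.exists_fibreProd p'
    (fun σ y => by cases y <;> rfl) (fun b => ⟨Sum.inr b, rfl⟩)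
  have ev₁₃ : ∀ b : ↥Mf, C₁₃.eval (C₁₃.output b) = b.1.prod := by
    intro b
    rw [hev₁₃, Finset.prod_filter, Fintype.prod_sum_type]
    simp only [p', Sum.elim_inl, Sum.elim_inr, id, hinl₁₂, hinr₁₂, hev₁₀, hev₁₁, ev₉, map_one]
    rw [Finset.prod_ite_eq' Finset.univ b, if_pos (Finset.mem_univ b), mul_one]
    -- the slots of `b`: product over `(ℓ, j)` with `ℓ ∈ b`, `j < count ℓ b`
    have step1 : (∏ y : {y // Yp y},
        if y.1.1 = b then (y.1.2.1.1 : MvPolynomial (Fin n × Fin n) ℂ) else 1) =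
        ∏ y ∈ Finset.univ.filter Yp,
          if y.1 = b then (y.2.1.1 : MvPolynomial (Fin n × Fin n) ℂ) else 1 :=
      (Finset.prod_subtype (Finset.univ.filter Yp) (by simp)
        (fun y : ↥Mf × ↥Lf × Fin s =>
          if y.1 = b then (y.2.1.1 : MvPolynomial (Fin n × Fin n) ℂ) else 1)).symm
    rw [step1, Finset.prod_filter, Fintype.prod_prod_type,
      Finset.prod_eq_single b (fun b' _ hb' => Finset.prod_eq_one fun z _ => by simp [hb'])
        (fun h => absurd (Finset.mem_univ b) h)]
    simp only [if_true, Fintype.prod_prod_type]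
    rw [show (∏ a : ↥Lf, ∏ j : Fin s,
          if Yp (b, a, j) then (a.1 : MvPolynomial (Fin n × Fin n) ℂ) else 1) =
        ∏ a : ↥Lf, if a.1 ∈ b.1 then a.1 ^ b.1.count a.1 else 1 from by
      refine Finset.prod_congr rfl fun a _ => ?_
      by_cases ha : a.1 ∈ b.1
      · simp only [Yp, ha, true_and, if_true]
        exact eqvTerms_prod_ite_lt s _ ((Multiset.count_le_card _ _).trans (h3 b.1
          (Multiset.mem_toFinset.1 b.2))) _
      · simp [Yp, ha]]
    rw [Finset.prod_coe_sort Lf (fun ℓ => if ℓ ∈ b.1 then ℓ ^ b.1.count ℓ else 1),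
      ← Finset.prod_filter, Finset.prod_multiset_count]
    refine Finset.prod_congr ?_ fun _ _ => rfl
    ext ℓ
    simp only [Finset.mem_filter, Multiset.mem_toFinset, and_iff_right_iff_imp]
    intro hℓ
    exact memLf.2 ⟨b.1, Multiset.mem_toFinset.1 b.2, hℓ⟩
  -- S6: outputs `m ↦ (count m T) · Π m`
  obtain ⟨G₁₄, i₁₄, C₁₄, hC₁₄, hev₁₄, hc₁₄⟩ := LabelledArithCircuit.exists_constOutputs (K := ℂ)
    (Fin n × Fin n) (Γ := Equiv.Perm (Fin n)) (fun b : ↥Mf => (T.count b.1 : ℂ))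
    (by
      intro σ b
      change ((T.count (b.1.map (ren σ)) : ℕ) : ℂ) = (T.count b.1 : ℂ)
      congr 1
      conv_lhs => rw [← h4' σ]
      exact Multiset.count_map_eq_count' _ _ (Multiset.map_injective (ren_inj σ)) _)
  obtain ⟨G₁₅, i₁₅, C₁₅, hC₁₅, hinl₁₅, hinr₁₅, hc₁₅⟩ := hC₁₄.exists_pairing hC₁₃
  obtain ⟨G₁₆, i₁₆, C₁₆, hC₁₆, hev₁₆, hc₁₆⟩ := hC₁₅.exists_hadamard
  -- S7: the orbit sum
  haveI : Nonempty ↥Mf := by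
    obtain ⟨m, hm⟩ := Multiset.exists_mem_of_ne_zero hT0
    exact ⟨⟨m, Multiset.mem_toFinset.2 hm⟩⟩
  obtain ⟨G, inst, C, hC, hev, hc⟩ := hC₁₆.exists_sumOutputs
  refine ⟨G, inst, C, hC, ?_, ?_⟩
  · rw [hev]
    simp only [hev₁₆, hinl₁₅, hinr₁₅, hev₁₄, ev₁₃]
    rw [Finset.sum_coe_sort Mf (fun m => MvPolynomial.C ((T.count m : ℕ) : ℂ) * m.prod),
      Finset.sum_multiset_map_count]
    refine Finset.sum_congr rfl fun m _ => ?_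
    rw [map_natCast, nsmul_eq_mul]
  · -- size bookkeeping
    have e₂ : Fintype.card (↥Lf × (Fin n × Fin n)) = Fintype.card ↥Lf * (n * n) := by
      rw [Fintype.card_prod, cardX]
    rw [e₂] at hc₂ hc₃ hc₅
    rw [cardX] at hc₁
    have e₁₂ : Fintype.card ({y // Yp y} ⊕ ↥Mf) = Fintype.card {y // Yp y} + Fintype.card ↥Mf :=
      Fintype.card_sum
    have : Fintype.card ↥Lf * (n * n) ≤ s * s * (n * n) := Nat.mul_le_mul_right _ cardA
    nlinarith [Nat.zero_le (n * n), Nat.zero_le (Fintype.card ↥Lf)]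

/-! ### Size bookkeeping -/

/-- `2n² + 4s²n² + 6s² + s⁴ + 6s + 6 ≤ 25 (n+2)² s⁴` for `s ≥ 1`. [folklore] -/
theorem eqvTerms_size_arith (n s : ℕ) (hs : 1 ≤ s) :
    2 * (n * n) + 4 * (s * s) * (n * n) + 6 * (s * s) + s ^ 4 + 6 * s + 6 ≤
      25 * (n + 2) ^ 2 * s ^ 4 := by
  have h1 : n * n ≤ (n + 2) ^ 2 := by nlinarith
  have h2 : s ≤ s ^ 4 := by
    calc s = s ^ 1 := (pow_one s).symm
      _ ≤ s ^ 4 := Nat.pow_le_pow_right hs (by norm_num)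
  have h3 : s * s ≤ s ^ 4 := by
    calc s * s = s ^ 2 := (sq s).symm
      _ ≤ s ^ 4 := Nat.pow_le_pow_right hs (by norm_num)
  have h4 : 1 ≤ s ^ 4 := Nat.one_le_pow _ _ hs
  have h5 : 1 ≤ (n + 2) ^ 2 := Nat.one_le_pow _ _ (by omega)
  nlinarith [Nat.mul_le_mul h1 h3, Nat.mul_le_mul h5 h4, Nat.mul_le_mul h5 h2,
    Nat.mul_le_mul h5 h3, Nat.mul_le_mul h1 h4]

end Summit.ValiantsHypothesis.ValiantsHypothesis.Theorems

end
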